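import Summits.Ventures.LatticeQCDFlow.Scoring.UNOnePlaquetteBesselDeterminant
import HarnessLib

/-!
# The `U(N)` one-plaquette law as a moment generating function: analyticity, `(log Z)' =` plaquette, monotonicity — every `N`

HONEST FRAMING: exact (Metropolis-corrected) sampling algorithms for lattice gauge theory;
figures of merit are autocorrelation/cost numbers at stated couplings and volumes; no
continuum-physics claim.

Venture `LatticeQCDFlow` (cell pub-lqcd), sub-topic `Scoring`; FANOUT row 5 (`s0-sun-a`), GEN-17.
NEW WORK of the cell (placement rule).  GEN-16 proved, for `SU(3)` on the Weyl torus, that the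
one-plaquette plaquette is `(log Z₃)'`, non-decreasing in the coupling, with derivative the plaquette
variance.  With GEN-17's closed forms on the HAAR measure for every `N` (`UNOnePlaquetteBesselDeterminant`:
`∫_{U(N)} e^{x Re tr U} dU = det[I_{|i−j|}(x)]`; `SUNOnePlaquetteBesselSeries`: `∫_{SU(N)} = Σ_q det[I_{|q+i−j|}(x)]`)
the same structure follows for ALL `N` and both groups at once, by reading the one-plaquette partition
function as the MOMENT GENERATING FUNCTION of the bounded observable `X = Re tr U` under Haar probability
(Mathlib's `ProbabilityTheory.mgf` / `cgf` calculus, `Mathlib/Probability/Moments/MGFAnalytic`):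

* §1 bounded observables: `integrableExpSet X μ = ℝ`, so `mgf`/`cgf` are real-analytic on all of `ℝ`,
  `(cgf)' = ∫ X e^{xX} / ∫ e^{xX}`, `(cgf)'' = ` the tilted variance `≥ 0`, `cgf` convex, `(cgf)'` monotone;
* §2 **`U(N)`**: `mgf (Re tr) Haar_{U(N)} = det[I_{|i−j|}]_{N×N}`, hence `x ↦ det[I_{|i−j|}(x)]` is
  real-analytic with derivative `∫ Re tr U e^{x Re tr U} dU`, `log det` is convex, and theory-2's `U(N)`
  one-plaquette PLAQUETTE `⟨(1/N) Re tr U⟩_β = (1/N) (log det[I_{|i−j|}])'(β)` is NON-DECREASING in `β`;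
* the `SU(N)` twin (`Σ_q det[I_{|q+i−j|}(x)]`, GEN-16's `SU(3)` monotonicity as the case `N = 3`) is the sequel
  `SUNOnePlaquetteHaarMGF.lean`; the cumulants at `β = 0`, the variance `(log Z)''/N²` and the weak-coupling limit
  `plaquette → 1` are in `UNOnePlaquetteCumulants.lean`.

No `def`, nothing cited as a fact, 0 sorry.
-/

noncomputable section

open Real MeasureTheory Finset Complex Set
open scoped ENNReal
open ProbabilityTheory
open Literature.MathematicalPhysics.QuantumFieldTheory
open Literature.MathematicalPhysics.QuantumLattice
open Literature.Analysis.FunctionSpaces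

namespace Summit.Ventures.LatticeQCDFlow.Scoring

/-! ### 1. Bounded observables: the `mgf`/`cgf` calculus holds on all of `ℝ` -/

section Bounded

variable {Ω : Type*} [MeasurableSpace Ω] {μ : Measure Ω} [IsFiniteMeasure μ] {X : Ω → ℝ} {C : ℝ}

/-- A bounded (a.e.-strongly measurable) observable has all exponential moments. -/
theorem integrable_exp_mul_of_abs_le_const (hX : AEStronglyMeasurable X μ) (hC : ∀ ω, |X ω| ≤ C) (t : ℝ) :
    Integrable (fun ω => Real.exp (t * X ω)) μ := by
  refine Integrable.mono' (integrable_const (Real.exp (|t| * C))) ?_ (Filter.Eventually.of_forall fun ω => ?_)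
  · exact (Real.continuous_exp.comp_aestronglyMeasurable (hX.const_mul t))
  · rw [Real.norm_of_nonneg (Real.exp_nonneg _)]
    refine Real.exp_le_exp.2 ((le_abs_self _).trans ?_)
    rw [abs_mul]
    exact mul_le_mul_of_nonneg_left (hC ω) (abs_nonneg _)

/-- For a bounded observable every real `t` is interior to `integrableExpSet X μ` (`= ℝ`). -/
theorem mem_interior_integrableExpSet_of_abs_le_const (hX : AEStronglyMeasurable X μ) (hC : ∀ ω, |X ω| ≤ C)
    (t : ℝ) : t ∈ interior (integrableExpSet X μ) := by
  have h : integrableExpSet X μ = Set.univ :=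
    Set.eq_univ_of_forall fun s => integrable_exp_mul_of_abs_le_const hX hC s
  rw [h, interior_univ]
  exact Set.mem_univ t

/-- **`cgf'' ≥ 0`** for a bounded observable: the second derivative of `log ∫ e^{xX}` is a tilted variance. -/
theorem iteratedDeriv_two_cgf_nonneg (hX : AEStronglyMeasurable X μ) (hC : ∀ ω, |X ω| ≤ C) (t : ℝ) :
    0 ≤ iteratedDeriv 2 (cgf X μ) t := by
  rw [iteratedDeriv_two_cgf_eq_integral (mem_interior_integrableExpSet_of_abs_le_const hX hC t)]
  exact div_nonneg (integral_nonneg fun ω => mul_nonneg (sq_nonneg _) (Real.exp_nonneg _)) (mgf_nonneg)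

/-- **`cgf` is real-analytic on `ℝ`** for a bounded observable. -/
theorem analyticOnNhd_cgf_univ (hX : AEStronglyMeasurable X μ) (hC : ∀ ω, |X ω| ≤ C) :
    AnalyticOnNhd ℝ (cgf X μ) Set.univ := fun t _ =>
  analyticAt_cgf (mem_interior_integrableExpSet_of_abs_le_const hX hC t)

/-- **`mgf` is real-analytic on `ℝ`** for a bounded observable. -/
theorem analyticOnNhd_mgf_univ (hX : AEStronglyMeasurable X μ) (hC : ∀ ω, |X ω| ≤ C) :
    AnalyticOnNhd ℝ (mgf X μ) Set.univ := fun t _ =>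
  analyticAt_mgf (mem_interior_integrableExpSet_of_abs_le_const hX hC t)

/-- **`cgf` is convex on `ℝ`** for a bounded observable (Hölder; here from `cgf'' ≥ 0`). -/
theorem convexOn_cgf_univ (hX : AEStronglyMeasurable X μ) (hC : ∀ ω, |X ω| ≤ C) :
    ConvexOn ℝ Set.univ (cgf X μ) := by
  have ha := analyticOnNhd_cgf_univ hX hC
  have hd : Differentiable ℝ (cgf X μ) := fun t => (ha t (Set.mem_univ t)).differentiableAt
  have hd' : Differentiable ℝ (deriv (cgf X μ)) := fun t => ((ha t (Set.mem_univ t)).deriv).differentiableAt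
  refine convexOn_of_deriv2_nonneg convex_univ hd.continuous.continuousOn (hd.differentiableOn)
    (hd'.differentiableOn) fun t _ => ?_
  rw [← iteratedDeriv_eq_iterate]
  exact iteratedDeriv_two_cgf_nonneg hX hC t

/-- **`(cgf)'` is monotone** for a bounded observable: the tilted mean `∫ X e^{xX}/∫ e^{xX}` is non-decreasing in `x`. -/
theorem monotone_deriv_cgf (hX : AEStronglyMeasurable X μ) (hC : ∀ ω, |X ω| ≤ C) :
    Monotone (deriv (cgf X μ)) := by
  have ha := analyticOnNhd_cgf_univ hX hC
  have hd' : Differentiable ℝ (deriv (cgf X μ)) := fun t => ((ha t (Set.mem_univ t)).deriv).differentiableAt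
  refine monotone_of_deriv_nonneg hd' fun t => ?_
  have h := iteratedDeriv_two_cgf_nonneg hX hC t
  rwa [iteratedDeriv_succ, iteratedDeriv_one] at h

end Bounded

/-! ### 2. `U(N)`: the Toeplitz determinant as a moment generating function -/

/-- `|Re tr U| ≤ N` on `U(N)` (every entry of a unitary matrix has modulus `≤ 1`). -/
theorem abs_trace_re_le_card {n : Type*} [Fintype n] [DecidableEq n] (u : Matrix.unitaryGroup n ℂ) :
    |((u : Matrix.unitaryGroup n ℂ) : Matrix n n ℂ).trace.re| ≤ Fintype.card n := by
  rw [Matrix.trace, Complex.re_sum]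
  calc |∑ i, (((u : Matrix.unitaryGroup n ℂ) : Matrix n n ℂ) i i).re|
      ≤ ∑ i, |(((u : Matrix.unitaryGroup n ℂ) : Matrix n n ℂ) i i).re| := Finset.abs_sum_le_sum_abs _ _
    _ ≤ ∑ _i : n, (1 : ℝ) := Finset.sum_le_sum fun i _ =>
        (Complex.abs_re_le_norm _).trans (entry_norm_bound_of_unitary u.2 i i)
    _ = Fintype.card n := by simp

/-- `Re tr` is a.e.-strongly measurable on `U(N)` (it is continuous). -/
theorem aestronglyMeasurable_trace_re_unitaryGroup (N : ℕ) :
    AEStronglyMeasurable (fun u : Matrix.unitaryGroup (Fin N) ℂ =>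
      ((u : Matrix.unitaryGroup (Fin N) ℂ) : Matrix (Fin N) (Fin N) ℂ).trace.re)
      (haarProbability (Matrix.unitaryGroup (Fin N) ℂ)) :=
  (Complex.continuous_re.comp (continuous_id.matrix_trace.comp continuous_subtype_val)).aestronglyMeasurable

/-- **`mgf_{Re tr U}(x) = det[I_{|i−j|}(x)]_{N×N}`** under the Haar probability of `U(N)`. -/
theorem mgf_trace_re_unitaryGroup (N : ℕ) (x : ℝ) :
    mgf (fun u : Matrix.unitaryGroup (Fin N) ℂ => ((u : Matrix.unitaryGroup (Fin N) ℂ) : Matrix (Fin N) (Fin N) ℂ).trace.re)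
        (haarProbability (Matrix.unitaryGroup (Fin N) ℂ)) x
      = (Matrix.of fun i j : Fin N => besselI ((i : ℤ) - (j : ℤ)).natAbs x).det :=
  integral_haar_unitaryGroup_fin_exp_mul_trace_re N x

/-- The same as an identity of functions of `x`. -/
theorem mgf_trace_re_unitaryGroup_eq (N : ℕ) :
    mgf (fun u : Matrix.unitaryGroup (Fin N) ℂ => ((u : Matrix.unitaryGroup (Fin N) ℂ) : Matrix (Fin N) (Fin N) ℂ).trace.re)
        (haarProbability (Matrix.unitaryGroup (Fin N) ℂ))
      = fun x => (Matrix.of fun i j : Fin N => besselI ((i : ℤ) - (j : ℤ)).natAbs x).det :=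
  funext (mgf_trace_re_unitaryGroup N)

/-- **The Toeplitz–Bessel determinant `x ↦ det[I_{|i−j|}(x)]_{N×N}` is real-analytic on `ℝ`.** -/
theorem analyticOnNhd_det_besselI_toeplitz (N : ℕ) :
    AnalyticOnNhd ℝ (fun x : ℝ => (Matrix.of fun i j : Fin N => besselI ((i : ℤ) - (j : ℤ)).natAbs x).det) Set.univ := by
  rw [← mgf_trace_re_unitaryGroup_eq]
  exact analyticOnNhd_mgf_univ (aestronglyMeasurable_trace_re_unitaryGroup N) (fun u => abs_trace_re_le_card u)

/-- **`d/dx det[I_{|i−j|}(x)] = ∫_{U(N)} Re tr U · e^{x Re tr U} dU`.** -/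
theorem hasDerivAt_det_besselI_toeplitz (N : ℕ) (x : ℝ) :
    HasDerivAt (fun x : ℝ => (Matrix.of fun i j : Fin N => besselI ((i : ℤ) - (j : ℤ)).natAbs x).det)
      (∫ u, ((u : Matrix.unitaryGroup (Fin N) ℂ) : Matrix (Fin N) (Fin N) ℂ).trace.re *
          Real.exp (x * ((u : Matrix.unitaryGroup (Fin N) ℂ) : Matrix (Fin N) (Fin N) ℂ).trace.re)
        ∂(haarProbability (Matrix.unitaryGroup (Fin N) ℂ))) x := by
  rw [← mgf_trace_re_unitaryGroup_eq]
  exact hasDerivAt_mgf (mem_interior_integrableExpSet_of_abs_le_const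
    (aestronglyMeasurable_trace_re_unitaryGroup N) (fun u => abs_trace_re_le_card u) x)

/-- **`log det[I_{|i−j|}(x)]` is convex on `ℝ`** (it is the cumulant generating function of `Re tr U`). -/
theorem convexOn_log_det_besselI_toeplitz (N : ℕ) :
    ConvexOn ℝ Set.univ (fun x : ℝ => Real.log (Matrix.of fun i j : Fin N => besselI ((i : ℤ) - (j : ℤ)).natAbs x).det) := by
  have h := convexOn_cgf_univ (aestronglyMeasurable_trace_re_unitaryGroup N) (fun u => abs_trace_re_le_card u)
  rwa [show cgf (fun u : Matrix.unitaryGroup (Fin N) ℂ => ((u : Matrix.unitaryGroup (Fin N) ℂ) :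
      Matrix (Fin N) (Fin N) ℂ).trace.re) (haarProbability (Matrix.unitaryGroup (Fin N) ℂ))
      = fun x => Real.log (Matrix.of fun i j : Fin N => besselI ((i : ℤ) - (j : ℤ)).natAbs x).det from
    funext fun x => by rw [cgf, mgf_trace_re_unitaryGroup]] at h

/-- **THEORY-2's `U(N)` ONE-PLAQUETTE PLAQUETTE IS `(1/N)(log det[I_{|i−j|}])'`**: for `N ≥ 1`,
`∫ (1/N) Re tr U e^{−β(N − Re tr U)} dU / ∫ e^{−β(N − Re tr U)} dU = (1/N) · (d/dβ) log det[I_{|i−j|}(β)]_{N×N}`. -/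
theorem unitary_plaquette_eq_deriv_log_det (N : ℕ) (β : ℝ) :
    (∫ u, ((u : Matrix.unitaryGroup (Fin N) ℂ) : Matrix (Fin N) (Fin N) ℂ).trace.re / N *
          Real.exp (-(β * ((N : ℝ) - ((u : Matrix.unitaryGroup (Fin N) ℂ) : Matrix (Fin N) (Fin N) ℂ).trace.re)))
        ∂(haarProbability (Matrix.unitaryGroup (Fin N) ℂ)))
      / (∫ u, Real.exp (-(β * ((N : ℝ) - ((u : Matrix.unitaryGroup (Fin N) ℂ) : Matrix (Fin N) (Fin N) ℂ).trace.re)))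
        ∂(haarProbability (Matrix.unitaryGroup (Fin N) ℂ)))
      = 1 / N * deriv (fun x : ℝ => Real.log (Matrix.of fun i j : Fin N => besselI ((i : ℤ) - (j : ℤ)).natAbs x).det) β := by
  have hint := mem_interior_integrableExpSet_of_abs_le_const
    (aestronglyMeasurable_trace_re_unitaryGroup N) (fun u => abs_trace_re_le_card u) β
  have hcgf : (fun x : ℝ => Real.log (Matrix.of fun i j : Fin N => besselI ((i : ℤ) - (j : ℤ)).natAbs x).det)
      = cgf (fun u : Matrix.unitaryGroup (Fin N) ℂ => ((u : Matrix.unitaryGroup (Fin N) ℂ) :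
          Matrix (Fin N) (Fin N) ℂ).trace.re) (haarProbability (Matrix.unitaryGroup (Fin N) ℂ)) :=
    funext fun x => by rw [cgf, mgf_trace_re_unitaryGroup]
  rw [hcgf, deriv_cgf hint, mgf]
  have hsplit : ∀ u : Matrix.unitaryGroup (Fin N) ℂ,
      Real.exp (-(β * ((N : ℝ) - ((u : Matrix.unitaryGroup (Fin N) ℂ) : Matrix (Fin N) (Fin N) ℂ).trace.re)))
        = Real.exp (-(N * β)) * Real.exp (β * ((u : Matrix.unitaryGroup (Fin N) ℂ) : Matrix (Fin N) (Fin N) ℂ).trace.re) := by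
    intro u; rw [← Real.exp_add]; congr 1; ring
  simp_rw [hsplit]
  have h1 : ∀ u : Matrix.unitaryGroup (Fin N) ℂ,
      ((u : Matrix.unitaryGroup (Fin N) ℂ) : Matrix (Fin N) (Fin N) ℂ).trace.re / N *
        (Real.exp (-(N * β)) * Real.exp (β * ((u : Matrix.unitaryGroup (Fin N) ℂ) : Matrix (Fin N) (Fin N) ℂ).trace.re))
      = Real.exp (-(N * β)) / N * (((u : Matrix.unitaryGroup (Fin N) ℂ) : Matrix (Fin N) (Fin N) ℂ).trace.re *
          Real.exp (β * ((u : Matrix.unitaryGroup (Fin N) ℂ) : Matrix (Fin N) (Fin N) ℂ).trace.re)) := by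
    intro u; ring
  simp_rw [h1]
  rw [integral_const_mul, integral_const_mul]
  have hZ : 0 < ∫ u, Real.exp (β * ((u : Matrix.unitaryGroup (Fin N) ℂ) : Matrix (Fin N) (Fin N) ℂ).trace.re)
      ∂(haarProbability (Matrix.unitaryGroup (Fin N) ℂ)) := by
    rw [integral_haar_unitaryGroup_fin_exp_mul_trace_re]; exact det_besselI_toeplitz_fin_pos N β
  have he : Real.exp (-(N * β)) ≠ 0 := (Real.exp_pos _).ne'
  by_cases hN : (N : ℝ) = 0
  · simp [hN]
  · field_simp

/-- **THE `U(N)` ONE-PLAQUETTE PLAQUETTE IS NON-DECREASING IN THE COUPLING, FOR EVERY `N`**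
(its `β`-derivative is `N⁻¹` times the tilted variance of `Re tr U`). -/
theorem monotone_unitary_plaquette (N : ℕ) :
    Monotone fun β : ℝ =>
      (∫ u, ((u : Matrix.unitaryGroup (Fin N) ℂ) : Matrix (Fin N) (Fin N) ℂ).trace.re / N *
          Real.exp (-(β * ((N : ℝ) - ((u : Matrix.unitaryGroup (Fin N) ℂ) : Matrix (Fin N) (Fin N) ℂ).trace.re)))
        ∂(haarProbability (Matrix.unitaryGroup (Fin N) ℂ)))
      / (∫ u, Real.exp (-(β * ((N : ℝ) - ((u : Matrix.unitaryGroup (Fin N) ℂ) : Matrix (Fin N) (Fin N) ℂ).trace.re)))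
        ∂(haarProbability (Matrix.unitaryGroup (Fin N) ℂ))) := by
  simp_rw [unitary_plaquette_eq_deriv_log_det]
  have hcgf : (fun x : ℝ => Real.log (Matrix.of fun i j : Fin N => besselI ((i : ℤ) - (j : ℤ)).natAbs x).det)
      = cgf (fun u : Matrix.unitaryGroup (Fin N) ℂ => ((u : Matrix.unitaryGroup (Fin N) ℂ) :
          Matrix (Fin N) (Fin N) ℂ).trace.re) (haarProbability (Matrix.unitaryGroup (Fin N) ℂ)) :=
    funext fun x => by rw [cgf, mgf_trace_re_unitaryGroup]
  rw [hcgf]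
  exact (monotone_deriv_cgf (aestronglyMeasurable_trace_re_unitaryGroup N) (fun u => abs_trace_re_le_card u)).const_mul
    (by positivity)

end Summit.Ventures.LatticeQCDFlow.Scoring
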